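import Summits.QuantumFields.YangMills.Theorems.LuscherReductionTwistedTraceScalingBOStiffDoor
import HarnessLib

/-!
# (B-ST) fibre assembly: from the door's QUADRATIC gap, an upper quasimode and its `L²(1/w)` defect to the BILINEAR fibre bound
# (lane A of S-BASE, crux `TwistedTraceScaling` stmt-QuantumFields-20203, C4-CORE, the (B-ST) pen; design card `pub/ym-fleet/ym-luscher-20007-p1/Lines-BST-poincare.md` (D))

After transport, the tube form of a core state `v` is `∫∫ k(u,u')·B(v_u, v_{u'}) du du'` with `B` the form of the central based-averaged fibre kernel; the slow factor is taken by the operator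
norm of `k` (`…BOStiffSlowTop`) applied to `u ↦ ‖v_u‖_w`, which needs a BILINEAR bound on `B(v_u, v_{u'})`.  This file derives it abstractly (finite measure space `(X, μ)`, bounded
measurable symmetric kernel `M`, profile `Θ ≥ 0` supported in `S`, weight `w ≥ w₀ > 0` on `S`, `Z = ∫ Θ²w > 0`) from: (PSD) `0 ≤ ∫∫ fMf` (`…BOStiffFibrePSD`); (UP) `(MΘ)(x) ≤ (1+η)ΛΘ(x)w(x)`
on `S`; (DEF) the `L²(1/w)` defect `∫_S ((MΘ) − ΛΘw)²/w ≤ η₂²Λ²Z` (the (OD) pen's currency — no pointwise two-sided quasimode is required, so the truncation ring of the profile is harmless);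
(GAP) the door's output `∫∫ hMh ≤ Λ(1−θ₁)‖h‖²_w` for `h ⊥_w Θ` supported in `S` (`…BOStiffDoor.form_le_of_quasimode_of_comparison`).
* §1 the form on bounded measurable functions: `kform_comm`, `kform_add_left`, `kform_smul_left`, ★ Cauchy–Schwarz `kform_sq_le` from (PSD);
* §2 ★ `cross_le_of_defect` — `|∫∫ ΘMh| ≤ η₂Λ√Z·‖h‖_w` for `h ⊥_w Θ` supported in `S` (weighted Cauchy–Schwarz `sq_setIntegral_abs_mul_le`);
* §3 ★★★ `kform_bilinear_bound` — for `f, f'` supported in `S`, `c(f) = ⟨f,Θ⟩_w/√Z` (`|c(f)| ≤ ‖f‖_w`):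
  `∫∫ fMf' ≤ Λ·[(1−θ₁)‖f‖_w‖f'‖_w + (1+η)|c(f)||c(f')| + η₂(|c(f)|‖f'‖_w + |c(f')|‖f‖_w)]` (`0 ≤ 1−θ₁`).
HONEST FRAMING: measure-theoretic bookkeeping for a stub of a child of the CONDITIONAL route R2b1; (B-ST) OPEN; C4-CORE OPEN; not infinite volume, not a gap, not Clay.
-/

set_option autoImplicit false

noncomputable section

open MeasureTheory

namespace Summit.QuantumFields.YangMills.Theorems.FemtoTransferGap.StiffDoor

variable {X : Type*} [MeasurableSpace X] {μ : Measure X} [IsFiniteMeasure μ]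


section Form

variable {M : X → X → ℝ} {CM : ℝ} (hM : Measurable (Function.uncurry M)) (hMb : ∀ x y, |M x y| ≤ CM)
include hM hMb

/-- The product integrand `f(x)M(x,y)g(y)` is integrable. [folklore] -/
theorem integrable_kform {f g : X → ℝ} (hf : Measurable f) {Cf : ℝ} (hCf : ∀ x, |f x| ≤ Cf) (hg : Measurable g) {Cg : ℝ} (hCg : ∀ x, |g x| ≤ Cg) :
    Integrable (fun p : X × X => f p.1 * M p.1 p.2 * g p.2) (μ.prod μ) := by
  refine integrable_of_measurable_abs_le _ (((hf.comp measurable_fst).mul hM).mul (hg.comp measurable_snd)) (C := Cf * CM * Cg) fun p => ?_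
  rw [abs_mul, abs_mul]
  have h0 : 0 ≤ Cf := (abs_nonneg _).trans (hCf p.1)
  exact mul_le_mul (mul_le_mul (hCf _) (hMb _ _) (abs_nonneg _) h0) (hCg _) (abs_nonneg _) (mul_nonneg h0 ((abs_nonneg _).trans (hMb p.1 p.2)))

/-- Iterated = product integral. [folklore] -/
theorem kform_eq_prod {f g : X → ℝ} (hf : Measurable f) {Cf : ℝ} (hCf : ∀ x, |f x| ≤ Cf) (hg : Measurable g) {Cg : ℝ} (hCg : ∀ x, |g x| ≤ Cg) :
    ∫ x, ∫ y, f x * M x y * g y ∂μ ∂μ = ∫ p, f p.1 * M p.1 p.2 * g p.2 ∂(μ.prod μ) :=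
  (integral_prod _ (integrable_kform (μ := μ) hM hMb hf hCf hg hCg)).symm

/-- ★ Symmetry `∫∫ fMg = ∫∫ gMf` (symmetric `M`). [folklore] -/
theorem kform_comm (hsymm : ∀ x y, M x y = M y x) {f g : X → ℝ} (hf : Measurable f) {Cf : ℝ} (hCf : ∀ x, |f x| ≤ Cf) (hg : Measurable g) {Cg : ℝ}
    (hCg : ∀ x, |g x| ≤ Cg) : ∫ x, ∫ y, f x * M x y * g y ∂μ ∂μ = ∫ x, ∫ y, g x * M x y * f y ∂μ ∂μ := by
  rw [kform_eq_prod hM hMb hf hCf hg hCg, kform_eq_prod hM hMb hg hCg hf hCf, ← integral_prod_swap]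
  refine integral_congr_ae (ae_of_all _ fun p => ?_)
  simp only [Prod.fst_swap, Prod.snd_swap, hsymm p.2 p.1]; ring

/-- Additivity in the left slot. [folklore] -/
theorem kform_add_left {f f' g : X → ℝ} (hf : Measurable f) {Cf : ℝ} (hCf : ∀ x, |f x| ≤ Cf) (hf' : Measurable f') {Cf' : ℝ} (hCf' : ∀ x, |f' x| ≤ Cf')
    (hg : Measurable g) {Cg : ℝ} (hCg : ∀ x, |g x| ≤ Cg) :
    ∫ x, ∫ y, (f x + f' x) * M x y * g y ∂μ ∂μ = (∫ x, ∫ y, f x * M x y * g y ∂μ ∂μ) + ∫ x, ∫ y, f' x * M x y * g y ∂μ ∂μ := by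
  have hs : Measurable fun x => f x + f' x := hf.add hf'
  have hsb : ∀ x, |f x + f' x| ≤ Cf + Cf' := fun x => (abs_add_le _ _).trans (add_le_add (hCf x) (hCf' x))
  rw [kform_eq_prod hM hMb hs hsb hg hCg, kform_eq_prod hM hMb hf hCf hg hCg, kform_eq_prod hM hMb hf' hCf' hg hCg,
    ← integral_add (integrable_kform hM hMb hf hCf hg hCg) (integrable_kform hM hMb hf' hCf' hg hCg)]
  exact integral_congr_ae (ae_of_all _ fun p => by ring)

omit [IsFiniteMeasure μ] hM hMb in
/-- Homogeneity in the left slot. [folklore] -/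
theorem kform_smul_left (a : ℝ) (f g : X → ℝ) : ∫ x, ∫ y, (a * f x) * M x y * g y ∂μ ∂μ = a * ∫ x, ∫ y, f x * M x y * g y ∂μ ∂μ := by
  rw [← integral_const_mul]
  refine integral_congr_ae (ae_of_all _ fun x => ?_)
  dsimp only
  rw [← integral_const_mul]
  exact integral_congr_ae (ae_of_all _ fun y => by ring)

/-- ★ **Cauchy–Schwarz from positive semi-definiteness**: `(∫∫ fMg)² ≤ (∫∫ fMf)(∫∫ gMg)`. [folklore] -/
theorem kform_sq_le (hsymm : ∀ x y, M x y = M y x) (hpsd : ∀ f : X → ℝ, Measurable f → (∃ C : ℝ, ∀ x, |f x| ≤ C) → 0 ≤ ∫ x, ∫ y, f x * M x y * f y ∂μ ∂μ)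
    {f g : X → ℝ} (hf : Measurable f) {Cf : ℝ} (hCf : ∀ x, |f x| ≤ Cf) (hg : Measurable g) {Cg : ℝ} (hCg : ∀ x, |g x| ≤ Cg) :
    (∫ x, ∫ y, f x * M x y * g y ∂μ ∂μ) ^ 2 ≤ (∫ x, ∫ y, f x * M x y * f y ∂μ ∂μ) * ∫ x, ∫ y, g x * M x y * g y ∂μ ∂μ := by
  set A := ∫ x, ∫ y, f x * M x y * f y ∂μ ∂μ
  set B := ∫ x, ∫ y, f x * M x y * g y ∂μ ∂μ
  set C := ∫ x, ∫ y, g x * M x y * g y ∂μ ∂μ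
  -- `0 ≤ Q(f + t g) = C t² + 2B t + A`
  have hquad : ∀ t : ℝ, 0 ≤ C * (t * t) + 2 * B * t + A := by
    intro t
    have htg : Measurable fun x => t * g x := hg.const_mul t
    have htgb : ∀ x, |t * g x| ≤ |t| * Cg := fun x => by rw [abs_mul]; exact mul_le_mul_of_nonneg_left (hCg x) (abs_nonneg _)
    have hs : Measurable fun x => f x + t * g x := hf.add htg
    have hsb : ∀ x, |f x + t * g x| ≤ Cf + |t| * Cg := fun x => (abs_add_le _ _).trans (add_le_add (hCf x) (htgb x))
    have h0 := hpsd (fun x => f x + t * g x) hs ⟨Cf + |t| * Cg, hsb⟩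
    have e1 : ∫ x, ∫ y, (f x + t * g x) * M x y * (f y + t * g y) ∂μ ∂μ =
        (∫ x, ∫ y, f x * M x y * (f y + t * g y) ∂μ ∂μ) + ∫ x, ∫ y, (t * g x) * M x y * (f y + t * g y) ∂μ ∂μ :=
      kform_add_left hM hMb hf hCf htg htgb hs hsb
    have e2 : ∫ x, ∫ y, f x * M x y * (f y + t * g y) ∂μ ∂μ = A + t * B := by
      rw [kform_comm hM hMb hsymm hf hCf hs hsb, kform_add_left hM hMb hf hCf htg htgb hf hCf, kform_smul_left, kform_comm hM hMb hsymm hg hCg hf hCf]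
    have e3 : ∫ x, ∫ y, (t * g x) * M x y * (f y + t * g y) ∂μ ∂μ = t * B + t * (t * C) := by
      rw [kform_smul_left, kform_comm hM hMb hsymm hg hCg hs hsb, kform_add_left hM hMb hf hCf htg htgb hg hCg, kform_smul_left]
      ring
    rw [e1, e2, e3] at h0
    nlinarith [h0]
  have hd := discrim_le_zero hquad
  rw [discrim] at hd
  nlinarith [hd]

end Form


section Cross

variable {M : X → X → ℝ} {Θ w h : X → ℝ} {CM CΘ Cw Ch : ℝ} {S : Set X} {Λ η₂ w₀ : ℝ}

/-- Weighted Cauchy–Schwarz: `(∫_S |h|·|D|)² ≤ (∫_S h²w)(∫_S D²/w)` for `w ≥ w₀ > 0` on `S` (discriminant of `∫_S (t|h|√w − |D|/√w)²`). [folklore] -/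
theorem sq_setIntegral_abs_mul_le {D : X → ℝ} {CD : ℝ} (hh : Measurable h) (hhb : ∀ x, |h x| ≤ Ch) (hD : Measurable D) (hDb : ∀ x, |D x| ≤ CD)
    (hw : Measurable w) (hwb : ∀ x, |w x| ≤ Cw) (hS : MeasurableSet S) (hw0 : 0 < w₀) (hwlo : ∀ x ∈ S, w₀ ≤ w x) :
    (∫ x in S, |h x| * |D x| ∂μ) ^ 2 ≤ (∫ x in S, h x ^ 2 * w x ∂μ) * ∫ x in S, D x ^ 2 / w x ∂μ := by
  set A := ∫ x in S, h x ^ 2 * w x ∂μ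
  set B := ∫ x in S, |h x| * |D x| ∂μ
  set C := ∫ x in S, D x ^ 2 / w x ∂μ
  have hCh : ∀ x, 0 ≤ Ch := fun x => (abs_nonneg _).trans (hhb x)
  have iA : Integrable (fun x => h x ^ 2 * w x) (μ.restrict S) := integrableOn_of_bdd ((hh.pow_const 2).mul hw) (C := Ch ^ 2 * Cw) fun x => by
    rw [abs_mul, abs_pow]; exact mul_le_mul (pow_le_pow_left₀ (abs_nonneg _) (hhb x) 2) (hwb x) (abs_nonneg _) (sq_nonneg _)
  have iB : Integrable (fun x => |h x| * |D x|) (μ.restrict S) := integrableOn_of_bdd (hh.abs.mul hD.abs) (C := Ch * CD) fun x => by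
    rw [abs_mul, abs_abs, abs_abs]; exact mul_le_mul (hhb x) (hDb x) (abs_nonneg _) (hCh x)
  -- on `S`, `D²/w ≤ CD²/w₀`; off `S` we do not integrate
  have iC : Integrable (fun x => D x ^ 2 / w x) (μ.restrict S) := by
    refine Integrable.mono' ((integrable_const (CD ^ 2 / w₀) : Integrable (fun _ : X => CD ^ 2 / w₀) (μ.restrict S))) ((hD.pow_const 2).div hw).aestronglyMeasurable ?_
    rw [ae_restrict_iff' hS]
    refine ae_of_all _ fun x hx => ?_
    have hwx : w₀ ≤ w x := hwlo x hx
    have hwpos : 0 < w x := hw0.trans_le hwx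
    rw [Real.norm_eq_abs, abs_div, abs_of_pos hwpos, abs_pow]
    exact div_le_div₀ (sq_nonneg _) (pow_le_pow_left₀ (abs_nonneg _) (hDb x) 2) hw0 hwx
  have hquad : ∀ t : ℝ, 0 ≤ A * (t * t) + (-(2 * B)) * t + C := by
    intro t
    have key : ∀ x ∈ S, (t * |h x| * Real.sqrt (w x) - |D x| / Real.sqrt (w x)) ^ 2 = (t ^ 2 * (h x ^ 2 * w x) - (2 * t) * (|h x| * |D x|)) + D x ^ 2 / w x :=
      fun x hx => by
        have hwpos : 0 < w x := hw0.trans_le (hwlo x hx)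
        have hs2 : Real.sqrt (w x) ^ 2 = w x := Real.sq_sqrt hwpos.le
        have hs0 : Real.sqrt (w x) ≠ 0 := (Real.sqrt_pos.2 hwpos).ne'
        have e : (t * |h x| * Real.sqrt (w x) - |D x| / Real.sqrt (w x)) ^ 2 =
            t ^ 2 * (|h x| ^ 2 * Real.sqrt (w x) ^ 2) - (2 * t) * (|h x| * |D x|) + |D x| ^ 2 / Real.sqrt (w x) ^ 2 := by
          field_simp
          ring
        rw [e, hs2, sq_abs, sq_abs]
    have h0 : 0 ≤ ∫ x in S, (t * |h x| * Real.sqrt (w x) - |D x| / Real.sqrt (w x)) ^ 2 ∂μ := integral_nonneg fun x => sq_nonneg _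
    rw [setIntegral_congr_fun hS key] at h0
    have i1 : Integrable (fun x => t ^ 2 * (h x ^ 2 * w x) - (2 * t) * (|h x| * |D x|)) (μ.restrict S) := (iA.const_mul _).sub (iB.const_mul _)
    rw [integral_add i1 iC, integral_sub (iA.const_mul _) (iB.const_mul _), integral_const_mul, integral_const_mul] at h0
    nlinarith [h0]
  have hd := discrim_le_zero hquad
  rw [discrim] at hd
  nlinarith [hd]

/-- ★ **The cross term from the defect.**  `M` symmetric bounded measurable; `Θ, w, h` bounded measurable; `h = 0` off the measurable set `S`, `∫ hΘw = 0`, `0 < w₀ ≤ w` on `S`; if the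
`L²(1/w)` defect of the quasimode satisfies `∫_S ((MΘ)(x) − ΛΘ(x)w(x))²/w(x) ≤ (η₂Λ)²·Z` (`η₂, Λ ≥ 0`), then `|∫∫ ΘMh| ≤ η₂Λ·√Z·√(∫ h²w)`. [folklore] -/
theorem cross_le_of_defect (hM : Measurable (Function.uncurry M)) (hMb : ∀ x y, |M x y| ≤ CM) (hsymm : ∀ x y, M x y = M y x)
    (hΘ : Measurable Θ) (hΘb : ∀ x, |Θ x| ≤ CΘ) (hw : Measurable w) (hwb : ∀ x, |w x| ≤ Cw) (hh : Measurable h) (hhb : ∀ x, |h x| ≤ Ch)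
    (hS : MeasurableSet S) (hhS : ∀ x, x ∉ S → h x = 0) (horth : ∫ x, h x * Θ x * w x ∂μ = 0) (hw0 : 0 < w₀) (hwlo : ∀ x ∈ S, w₀ ≤ w x)
    (hΛ : 0 ≤ Λ) (hη₂ : 0 ≤ η₂) {Z : ℝ} (hZ : 0 ≤ Z)
    (hdef : ∫ x in S, ((∫ y, M x y * Θ y ∂μ) - Λ * (Θ x * w x)) ^ 2 / w x ∂μ ≤ (η₂ * Λ) ^ 2 * Z) :
    |∫ x, ∫ y, Θ x * M x y * h y ∂μ ∂μ| ≤ η₂ * Λ * Real.sqrt Z * Real.sqrt (∫ x, h x ^ 2 * w x ∂μ) := by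
  -- `∫∫ ΘMh = ∫ h·(MΘ) = ∫_S h·((MΘ) − ΛΘw)`
  obtain ⟨hIm, hIb⟩ := measurable_integral_right_of_bdd (μ := μ) (F := fun x y => M x y * Θ y) (hM.mul (hΘ.comp measurable_snd)) (C := CM * CΘ) fun x y => by
    rw [abs_mul]; exact mul_le_mul (hMb x y) (hΘb y) (abs_nonneg _) ((abs_nonneg _).trans (hMb x y))
  set D : X → ℝ := fun x => (∫ y, M x y * Θ y ∂μ) - Λ * (Θ x * w x) with hDdef
  have hDm : Measurable D := hIm.sub ((hΘ.mul hw).const_mul Λ)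
  have hDb : ∀ x, |D x| ≤ CM * CΘ * μ.real Set.univ + |Λ| * (CΘ * Cw) := fun x => by
    refine (abs_sub _ _).trans (add_le_add (hIb x) ?_)
    rw [abs_mul, abs_mul]; exact mul_le_mul_of_nonneg_left (mul_le_mul (hΘb x) (hwb x) (abs_nonneg _) ((abs_nonneg _).trans (hΘb x))) (abs_nonneg _)
  have e1 : ∫ x, ∫ y, Θ x * M x y * h y ∂μ ∂μ = ∫ x, h x * ∫ y, M x y * Θ y ∂μ ∂μ := by
    rw [kform_comm (μ := μ) hM hMb hsymm hΘ hΘb hh hhb]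
    refine integral_congr_ae (ae_of_all _ fun x => ?_)
    dsimp only
    rw [← integral_const_mul]
    exact integral_congr_ae (ae_of_all _ fun y => by ring)
  have e2 : ∫ x, h x * ∫ y, M x y * Θ y ∂μ ∂μ = ∫ x in S, h x * D x ∂μ := by
    rw [setIntegral_eq_integral_of_forall_compl_eq_zero fun x hx => by rw [hhS x hx, zero_mul]]
    have ih : Integrable (fun x => h x * ∫ y, M x y * Θ y ∂μ) μ := integrable_of_measurable_abs_le μ (hh.mul hIm) (C := Ch * (CM * CΘ * μ.real Set.univ)) fun x => by
      rw [abs_mul]; exact mul_le_mul (hhb x) (hIb x) (abs_nonneg _) ((abs_nonneg _).trans (hhb x))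
    have ih2 : Integrable (fun x => Λ * (h x * Θ x * w x)) μ := (integrable_of_measurable_abs_le μ (f := fun x => h x * Θ x * w x) ((hh.mul hΘ).mul hw) (C := Ch * CΘ * Cw) fun x => by
      rw [abs_mul, abs_mul]
      exact mul_le_mul (mul_le_mul (hhb x) (hΘb x) (abs_nonneg _) ((abs_nonneg _).trans (hhb x))) (hwb x) (abs_nonneg _)
        (mul_nonneg ((abs_nonneg _).trans (hhb x)) ((abs_nonneg _).trans (hΘb x)))).const_mul Λ
    have e : (fun x => h x * D x) = fun x => h x * ∫ y, M x y * Θ y ∂μ - Λ * (h x * Θ x * w x) := funext fun x => by simp only [hDdef]; ring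
    rw [e, integral_sub ih ih2, integral_const_mul, horth, mul_zero, sub_zero]
  rw [e1, e2]
  -- weighted Cauchy–Schwarz on `S`
  have hcs := sq_setIntegral_abs_mul_le (μ := μ) hh hhb hDm hDb hw hwb hS hw0 hwlo
  have hN : ∫ x in S, h x ^ 2 * w x ∂μ = ∫ x, h x ^ 2 * w x ∂μ := setIntegral_eq_integral_of_forall_compl_eq_zero fun x hx => by rw [hhS x hx]; ring
  rw [hN] at hcs
  have hN0 : 0 ≤ ∫ x, h x ^ 2 * w x ∂μ := by
    rw [← hN]; exact setIntegral_nonneg hS fun x hx => mul_nonneg (sq_nonneg _) (hw0.le.trans (hwlo x hx))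
  have h1 : |∫ x in S, h x * D x ∂μ| ≤ ∫ x in S, |h x| * |D x| ∂μ := by
    refine (abs_integral_le_integral_abs).trans (le_of_eq (integral_congr_ae (ae_of_all _ fun x => ?_)))
    simp only [abs_mul]
  have hB0 : 0 ≤ ∫ x in S, |h x| * |D x| ∂μ := integral_nonneg fun x => mul_nonneg (abs_nonneg _) (abs_nonneg _)
  have hT0 : 0 ≤ η₂ * Λ * Real.sqrt Z * Real.sqrt (∫ x, h x ^ 2 * w x ∂μ) := by positivity
  have h2 : (∫ x in S, |h x| * |D x| ∂μ) ^ 2 ≤ (∫ x, h x ^ 2 * w x ∂μ) * ((η₂ * Λ) ^ 2 * Z) := hcs.trans (mul_le_mul_of_nonneg_left hdef hN0)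
  have hr : (η₂ * Λ * Real.sqrt Z * Real.sqrt (∫ x, h x ^ 2 * w x ∂μ)) ^ 2 = (∫ x, h x ^ 2 * w x ∂μ) * ((η₂ * Λ) ^ 2 * Z) := by
    rw [mul_pow, mul_pow, Real.sq_sqrt hZ, Real.sq_sqrt hN0]; ring
  have h3 : ∫ x in S, |h x| * |D x| ∂μ ≤ η₂ * Λ * Real.sqrt Z * Real.sqrt (∫ x, h x ^ 2 * w x ∂μ) :=
    calc ∫ x in S, |h x| * |D x| ∂μ = Real.sqrt ((∫ x in S, |h x| * |D x| ∂μ) ^ 2) := (Real.sqrt_sq hB0).symm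
      _ ≤ Real.sqrt ((∫ x, h x ^ 2 * w x ∂μ) * ((η₂ * Λ) ^ 2 * Z)) := Real.sqrt_le_sqrt h2
      _ = η₂ * Λ * Real.sqrt Z * Real.sqrt (∫ x, h x ^ 2 * w x ∂μ) := by rw [← hr, Real.sqrt_sq hT0]
  exact h1.trans h3
end Cross


/-! ## §3 ★★★ The bilinear fibre bound -/

section Bilinear

variable {M : X → X → ℝ} {Θ w : X → ℝ} {CM CΘ Cw : ℝ} {S : Set X} {Λ η η₂ θ₁ w₀ : ℝ}

/-- The `w`-norm of `f − aΘ`, `a = ⟨f,Θ⟩_w/Z`: `∫ (f − aΘ)²w = ∫ f²w − ⟨f,Θ⟩_w²/Z ≤ ∫ f²w`. [folklore] -/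
theorem integral_sub_proj_sq (hΘ : Measurable Θ) (hΘb : ∀ x, |Θ x| ≤ CΘ) (hw : Measurable w) (hwb : ∀ x, |w x| ≤ Cw) {f : X → ℝ} (hf : Measurable f) {Cf : ℝ}
    (hCf : ∀ x, |f x| ≤ Cf) (hZ : 0 < ∫ x, Θ x ^ 2 * w x ∂μ) :
    ∫ x, (f x - (∫ y, f y * Θ y * w y ∂μ) / (∫ y, Θ y ^ 2 * w y ∂μ) * Θ x) ^ 2 * w x ∂μ =
      (∫ x, f x ^ 2 * w x ∂μ) - (∫ x, f x * Θ x * w x ∂μ) ^ 2 / ∫ x, Θ x ^ 2 * w x ∂μ := by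
  set Z := ∫ y, Θ y ^ 2 * w y ∂μ
  set m := ∫ y, f y * Θ y * w y ∂μ
  set a := m / Z
  have hCf0 : ∀ x, 0 ≤ Cf := fun x => (abs_nonneg _).trans (hCf x)
  have iN : Integrable (fun x => f x ^ 2 * w x) μ := integrable_of_measurable_abs_le μ ((hf.pow_const 2).mul hw) (C := Cf ^ 2 * Cw) fun x => by
    rw [abs_mul, abs_pow]; exact mul_le_mul (pow_le_pow_left₀ (abs_nonneg _) (hCf x) 2) (hwb x) (abs_nonneg _) (sq_nonneg _)
  have im : Integrable (fun x => f x * Θ x * w x) μ := integrable_of_measurable_abs_le μ ((hf.mul hΘ).mul hw) (C := Cf * CΘ * Cw) fun x => by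
    rw [abs_mul, abs_mul]
    exact mul_le_mul (mul_le_mul (hCf x) (hΘb x) (abs_nonneg _) (hCf0 x)) (hwb x) (abs_nonneg _) (mul_nonneg (hCf0 x) ((abs_nonneg _).trans (hΘb x)))
  have iZ : Integrable (fun x => Θ x ^ 2 * w x) μ := integrable_of_measurable_abs_le μ ((hΘ.pow_const 2).mul hw) (C := CΘ ^ 2 * Cw) fun x => by
    rw [abs_mul, abs_pow]; exact mul_le_mul (pow_le_pow_left₀ (abs_nonneg _) (hΘb x) 2) (hwb x) (abs_nonneg _) (sq_nonneg _)
  have e : (fun x => (f x - a * Θ x) ^ 2 * w x) = fun x => (f x ^ 2 * w x - (2 * a) * (f x * Θ x * w x)) + a ^ 2 * (Θ x ^ 2 * w x) := funext fun x => by ring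
  have i1 : Integrable (fun x => f x ^ 2 * w x - (2 * a) * (f x * Θ x * w x)) μ := iN.sub (im.const_mul _)
  rw [e, integral_add i1 (iZ.const_mul _), integral_sub iN (im.const_mul _), integral_const_mul, integral_const_mul]
  simp only [a]
  field_simp
  ring

set_option maxHeartbeats 800000 in
-- one long real-arithmetic assembly over many `set` abbreviations (four blocks, bilinear expansion); the heartbeats go into `linarith`/`ring` bookkeeping, not search.
/-- ★★★ **THE BILINEAR FIBRE BOUND.**  See the module docstring for the hypotheses (PSD), (UP), (DEF), (GAP).  For `f, f'` bounded measurable supported in `S`, with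
`c(f) = ⟨f,Θ⟩_w/√Z`, `Z = ∫ Θ²w`:
`∫∫ f M f' ≤ Λ·[(1−θ₁)·√(∫f²w)√(∫f'²w) + (1+η)·|c(f)|·|c(f')| + η₂·(|c(f)|·√(∫f'²w) + |c(f')|·√(∫f²w))]`. [cite: Helffer2013, §7] -/
theorem kform_bilinear_bound (hM : Measurable (Function.uncurry M)) (hMb : ∀ x y, |M x y| ≤ CM) (hsymm : ∀ x y, M x y = M y x)
    (hpsd : ∀ f : X → ℝ, Measurable f → (∃ C : ℝ, ∀ x, |f x| ≤ C) → 0 ≤ ∫ x, ∫ y, f x * M x y * f y ∂μ ∂μ)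
    (hΘ : Measurable Θ) (hΘb : ∀ x, |Θ x| ≤ CΘ) (hΘ0 : ∀ x, 0 ≤ Θ x) (hΘS : ∀ x, x ∉ S → Θ x = 0) (hw : Measurable w) (hwb : ∀ x, |w x| ≤ Cw)
    (hS : MeasurableSet S) (hw0 : 0 < w₀) (hwlo : ∀ x ∈ S, w₀ ≤ w x) (hZ : 0 < ∫ x, Θ x ^ 2 * w x ∂μ) (hΛ : 0 ≤ Λ) (hη₂ : 0 ≤ η₂) (hθ : 0 ≤ 1 - θ₁)
    (hup : ∀ x ∈ S, ∫ y, M x y * Θ y ∂μ ≤ (1 + η) * Λ * (Θ x * w x))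
    (hdef : ∫ x in S, ((∫ y, M x y * Θ y ∂μ) - Λ * (Θ x * w x)) ^ 2 / w x ∂μ ≤ (η₂ * Λ) ^ 2 * ∫ x, Θ x ^ 2 * w x ∂μ)
    (hgap : ∀ h : X → ℝ, Measurable h → (∃ C : ℝ, ∀ x, |h x| ≤ C) → (∀ x, x ∉ S → h x = 0) → ∫ x, h x * Θ x * w x ∂μ = 0 →
      ∫ x, ∫ y, h x * M x y * h y ∂μ ∂μ ≤ Λ * ((1 - θ₁) * ∫ x, h x ^ 2 * w x ∂μ))
    {f f' : X → ℝ} (hf : Measurable f) {Cf : ℝ} (hCf : ∀ x, |f x| ≤ Cf) (hfS : ∀ x, x ∉ S → f x = 0) (hf' : Measurable f') {Cf' : ℝ} (hCf' : ∀ x, |f' x| ≤ Cf')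
    (hf'S : ∀ x, x ∉ S → f' x = 0) :
    ∫ x, ∫ y, f x * M x y * f' y ∂μ ∂μ ≤
      Λ * ((1 - θ₁) * (Real.sqrt (∫ x, f x ^ 2 * w x ∂μ) * Real.sqrt (∫ x, f' x ^ 2 * w x ∂μ)) +
        (1 + η) * (|∫ x, f x * Θ x * w x ∂μ| / Real.sqrt (∫ x, Θ x ^ 2 * w x ∂μ) * (|∫ x, f' x * Θ x * w x ∂μ| / Real.sqrt (∫ x, Θ x ^ 2 * w x ∂μ))) +
        η₂ * (|∫ x, f x * Θ x * w x ∂μ| / Real.sqrt (∫ x, Θ x ^ 2 * w x ∂μ) * Real.sqrt (∫ x, f' x ^ 2 * w x ∂μ) +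
          |∫ x, f' x * Θ x * w x ∂μ| / Real.sqrt (∫ x, Θ x ^ 2 * w x ∂μ) * Real.sqrt (∫ x, f x ^ 2 * w x ∂μ))) := by
  set Z := ∫ x, Θ x ^ 2 * w x ∂μ with hZdef
  set m := ∫ x, f x * Θ x * w x ∂μ with hmdef
  set m' := ∫ x, f' x * Θ x * w x ∂μ with hm'def
  set N := ∫ x, f x ^ 2 * w x ∂μ with hNdef
  set N' := ∫ x, f' x ^ 2 * w x ∂μ with hN'def
  have hsZ : 0 < Real.sqrt Z := Real.sqrt_pos.2 hZ
  have hCΘ0 : ∀ x, 0 ≤ CΘ := fun x => (abs_nonneg _).trans (hΘb x)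
  -- the decomposition `f = aΘ + h`
  set a : ℝ := m / Z with ha
  set a' : ℝ := m' / Z with ha'
  set h : X → ℝ := fun x => f x - a * Θ x with hh
  set h' : X → ℝ := fun x => f' x - a' * Θ x with hh'
  have hhm : Measurable h := hf.sub (hΘ.const_mul a)
  have hh'm : Measurable h' := hf'.sub (hΘ.const_mul a')
  have hΘam : Measurable fun x => a * Θ x := hΘ.const_mul a
  have hΘab : ∀ x, |a * Θ x| ≤ |a| * CΘ := fun x => by rw [abs_mul]; exact mul_le_mul_of_nonneg_left (hΘb x) (abs_nonneg _)
  have hΘa'm : Measurable fun x => a' * Θ x := hΘ.const_mul a'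
  have hΘa'b : ∀ x, |a' * Θ x| ≤ |a'| * CΘ := fun x => by rw [abs_mul]; exact mul_le_mul_of_nonneg_left (hΘb x) (abs_nonneg _)
  have hhb : ∀ x, |h x| ≤ Cf + |a| * CΘ := fun x => (abs_sub _ _).trans (add_le_add (hCf x) (hΘab x))
  have hh'b : ∀ x, |h' x| ≤ Cf' + |a'| * CΘ := fun x => (abs_sub _ _).trans (add_le_add (hCf' x) (hΘa'b x))
  have hhS : ∀ x, x ∉ S → h x = 0 := fun x hx => by simp only [hh, hfS x hx, hΘS x hx, mul_zero, sub_zero]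
  have hh'S : ∀ x, x ∉ S → h' x = 0 := fun x hx => by simp only [hh', hf'S x hx, hΘS x hx, mul_zero, sub_zero]
  have iprod : ∀ {g : X → ℝ} {Cg : ℝ}, Measurable g → (∀ x, |g x| ≤ Cg) → Integrable (fun x => g x * Θ x * w x) μ := fun {g Cg} hg hCg =>
    integrable_of_measurable_abs_le μ (f := fun x => g x * Θ x * w x) ((hg.mul hΘ).mul hw) (C := Cg * CΘ * Cw) fun x => by
      rw [abs_mul, abs_mul]
      exact mul_le_mul (mul_le_mul (hCg x) (hΘb x) (abs_nonneg _) ((abs_nonneg _).trans (hCg x))) (hwb x) (abs_nonneg _)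
        (mul_nonneg ((abs_nonneg _).trans (hCg x)) (hCΘ0 x))
  have iZ : Integrable (fun x => Θ x ^ 2 * w x) μ := integrable_of_measurable_abs_le μ ((hΘ.pow_const 2).mul hw) (C := CΘ ^ 2 * Cw) fun x => by
    rw [abs_mul, abs_pow]; exact mul_le_mul (pow_le_pow_left₀ (abs_nonneg _) (hΘb x) 2) (hwb x) (abs_nonneg _) (sq_nonneg _)
  have horth : ∀ {g : X → ℝ} {Cg : ℝ}, Measurable g → (∀ x, |g x| ≤ Cg) →
      ∫ x, (g x - (∫ y, g y * Θ y * w y ∂μ) / Z * Θ x) * Θ x * w x ∂μ = 0 := fun {g Cg} hg hCg => by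
    have e : (fun x => (g x - (∫ y, g y * Θ y * w y ∂μ) / Z * Θ x) * Θ x * w x) =
        fun x => g x * Θ x * w x - ((∫ y, g y * Θ y * w y ∂μ) / Z) * (Θ x ^ 2 * w x) := funext fun x => by ring
    rw [e, integral_sub (iprod hg hCg) (iZ.const_mul _), integral_const_mul]
    field_simp
    ring
  have hho : ∫ x, h x * Θ x * w x ∂μ = 0 := horth hf hCf
  have hh'o : ∫ x, h' x * Θ x * w x ∂μ = 0 := horth hf' hCf'
  have hNh : ∫ x, h x ^ 2 * w x ∂μ = N - m ^ 2 / Z := integral_sub_proj_sq (μ := μ) hΘ hΘb hw hwb hf hCf hZ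
  have hNh' : ∫ x, h' x ^ 2 * w x ∂μ = N' - m' ^ 2 / Z := integral_sub_proj_sq (μ := μ) hΘ hΘb hw hwb hf' hCf' hZ
  have hNh0 : 0 ≤ ∫ x, h x ^ 2 * w x ∂μ := by
    rw [← setIntegral_eq_integral_of_forall_compl_eq_zero (s := S) fun x hx => by rw [hhS x hx]; ring]
    exact setIntegral_nonneg hS fun x hx => mul_nonneg (sq_nonneg _) (hw0.le.trans (hwlo x hx))
  have hNh'0 : 0 ≤ ∫ x, h' x ^ 2 * w x ∂μ := by
    rw [← setIntegral_eq_integral_of_forall_compl_eq_zero (s := S) fun x hx => by rw [hh'S x hx]; ring]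
    exact setIntegral_nonneg hS fun x hx => mul_nonneg (sq_nonneg _) (hw0.le.trans (hwlo x hx))
  have hN0 : 0 ≤ N := by have := div_nonneg (sq_nonneg m) hZ.le; linarith [hNh]
  have hN'0 : 0 ≤ N' := by have := div_nonneg (sq_nonneg m') hZ.le; linarith [hNh']
  have hnh_le : Real.sqrt (∫ x, h x ^ 2 * w x ∂μ) ≤ Real.sqrt N := Real.sqrt_le_sqrt (by rw [hNh]; linarith [div_nonneg (sq_nonneg m) hZ.le])
  have hnh'_le : Real.sqrt (∫ x, h' x ^ 2 * w x ∂μ) ≤ Real.sqrt N' := Real.sqrt_le_sqrt (by rw [hNh']; linarith [div_nonneg (sq_nonneg m') hZ.le])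
  -- (1) `B(Θ,Θ) ≤ (1+η)ΛZ`
  obtain ⟨hIm, hIb⟩ := measurable_integral_right_of_bdd (μ := μ) (F := fun x y => M x y * Θ y) (hM.mul (hΘ.comp measurable_snd)) (C := CM * CΘ) fun x y => by
    rw [abs_mul]; exact mul_le_mul (hMb x y) (hΘb y) (abs_nonneg _) ((abs_nonneg _).trans (hMb x y))
  have hB11 : ∫ x, ∫ y, Θ x * M x y * Θ y ∂μ ∂μ ≤ (1 + η) * Λ * Z := by
    have e : ∫ x, ∫ y, Θ x * M x y * Θ y ∂μ ∂μ = ∫ x, Θ x * ∫ y, M x y * Θ y ∂μ ∂μ := by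
      refine integral_congr_ae (ae_of_all _ fun x => ?_); dsimp only; rw [← integral_const_mul]; exact integral_congr_ae (ae_of_all _ fun y => by ring)
    rw [e, hZdef, ← integral_const_mul]
    refine integral_mono (integrable_of_measurable_abs_le μ (hΘ.mul hIm) (C := CΘ * (CM * CΘ * μ.real Set.univ)) fun x => by
      rw [abs_mul]; exact mul_le_mul (hΘb x) (hIb x) (abs_nonneg _) (hCΘ0 x)) (iZ.const_mul _) fun x => ?_
    dsimp only
    by_cases hx : x ∈ S
    · have := mul_le_mul_of_nonneg_left (hup x hx) (hΘ0 x)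
      calc Θ x * ∫ y, M x y * Θ y ∂μ ≤ Θ x * ((1 + η) * Λ * (Θ x * w x)) := this
        _ = (1 + η) * Λ * (Θ x ^ 2 * w x) := by ring
    · rw [hΘS x hx]; simp
  -- (2) cross terms
  have hX1 : |∫ x, ∫ y, Θ x * M x y * h' y ∂μ ∂μ| ≤ η₂ * Λ * Real.sqrt Z * Real.sqrt (∫ x, h' x ^ 2 * w x ∂μ) :=
    cross_le_of_defect (μ := μ) hM hMb hsymm hΘ hΘb hw hwb hh'm hh'b hS hh'S hh'o hw0 hwlo hΛ hη₂ hZ.le hdef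
  have hX2 : |∫ x, ∫ y, h x * M x y * Θ y ∂μ ∂μ| ≤ η₂ * Λ * Real.sqrt Z * Real.sqrt (∫ x, h x ^ 2 * w x ∂μ) := by
    rw [kform_comm (μ := μ) hM hMb hsymm hhm hhb hΘ hΘb]
    exact cross_le_of_defect (μ := μ) hM hMb hsymm hΘ hΘb hw hwb hhm hhb hS hhS hho hw0 hwlo hΛ hη₂ hZ.le hdef
  -- (3) `B(h,h') ≤ Λ(1−θ₁)‖h‖‖h'‖`
  have hBhh : ∫ x, ∫ y, h x * M x y * h y ∂μ ∂μ ≤ Λ * ((1 - θ₁) * ∫ x, h x ^ 2 * w x ∂μ) := hgap h hhm ⟨_, hhb⟩ hhS hho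
  have hBh'h' : ∫ x, ∫ y, h' x * M x y * h' y ∂μ ∂μ ≤ Λ * ((1 - θ₁) * ∫ x, h' x ^ 2 * w x ∂μ) := hgap h' hh'm ⟨_, hh'b⟩ hh'S hh'o
  have hB0h : 0 ≤ ∫ x, ∫ y, h x * M x y * h y ∂μ ∂μ := hpsd h hhm ⟨_, hhb⟩
  have hB0h' : 0 ≤ ∫ x, ∫ y, h' x * M x y * h' y ∂μ ∂μ := hpsd h' hh'm ⟨_, hh'b⟩
  have hCS := kform_sq_le (μ := μ) hM hMb hsymm hpsd hhm hhb hh'm hh'b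
  have hX3 : ∫ x, ∫ y, h x * M x y * h' y ∂μ ∂μ ≤ Λ * (1 - θ₁) * (Real.sqrt (∫ x, h x ^ 2 * w x ∂μ) * Real.sqrt (∫ x, h' x ^ 2 * w x ∂μ)) := by
    set T := Λ * (1 - θ₁) * (Real.sqrt (∫ x, h x ^ 2 * w x ∂μ) * Real.sqrt (∫ x, h' x ^ 2 * w x ∂μ))
    have hT0 : 0 ≤ T := by positivity
    have hT2 : (∫ x, ∫ y, h x * M x y * h y ∂μ ∂μ) * (∫ x, ∫ y, h' x * M x y * h' y ∂μ ∂μ) ≤ T ^ 2 := by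
      have e : T ^ 2 = (Λ * ((1 - θ₁) * ∫ x, h x ^ 2 * w x ∂μ)) * (Λ * ((1 - θ₁) * ∫ x, h' x ^ 2 * w x ∂μ)) := by
        simp only [T]; rw [mul_pow, mul_pow, mul_pow, Real.sq_sqrt hNh0, Real.sq_sqrt hNh'0]; ring
      rw [e]; exact mul_le_mul hBhh hBh'h' hB0h' (hB0h.trans hBhh)
    have h3 := hCS.trans hT2
    exact abs_le_of_sq_le_sq' h3 hT0 |>.2
  -- (4) bilinear expansion `B(f,f') = aa'B(Θ,Θ) + aB(Θ,h') + a'B(h,Θ) + B(h,h')`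
  have ef : f = fun x => a * Θ x + h x := funext fun x => by simp only [hh]; ring
  have ef' : f' = fun x => a' * Θ x + h' x := funext fun x => by simp only [hh']; ring
  have hs' : Measurable fun x => a' * Θ x + h' x := hΘa'm.add hh'm
  have hs'b : ∀ x, |a' * Θ x + h' x| ≤ |a'| * CΘ + (Cf' + |a'| * CΘ) := fun x => (abs_add_le _ _).trans (add_le_add (hΘa'b x) (hh'b x))
  have hexp : ∫ x, ∫ y, f x * M x y * f' y ∂μ ∂μ =
      a * a' * (∫ x, ∫ y, Θ x * M x y * Θ y ∂μ ∂μ) + a * (∫ x, ∫ y, Θ x * M x y * h' y ∂μ ∂μ) + a' * (∫ x, ∫ y, h x * M x y * Θ y ∂μ ∂μ) +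
        ∫ x, ∫ y, h x * M x y * h' y ∂μ ∂μ := by
    rw [ef, ef']
    show ∫ x, ∫ y, (a * Θ x + h x) * M x y * (a' * Θ y + h' y) ∂μ ∂μ = _
    rw [kform_add_left (μ := μ) hM hMb hΘam hΘab hhm hhb hs' hs'b]
    rw [kform_comm (μ := μ) hM hMb hsymm hΘam hΘab hs' hs'b, kform_comm (μ := μ) hM hMb hsymm hhm hhb hs' hs'b,
      kform_add_left (μ := μ) hM hMb hΘa'm hΘa'b hh'm hh'b hΘam hΘab, kform_add_left (μ := μ) hM hMb hΘa'm hΘa'b hh'm hh'b hhm hhb,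
      kform_smul_left (μ := μ), kform_smul_left (μ := μ),
      kform_comm (μ := μ) hM hMb hsymm hΘ hΘb hΘam hΘab, kform_comm (μ := μ) hM hMb hsymm hh'm hh'b hΘam hΘab,
      kform_comm (μ := μ) hM hMb hsymm hΘ hΘb hhm hhb, kform_comm (μ := μ) hM hMb hsymm hh'm hh'b hhm hhb,
      kform_smul_left (μ := μ), kform_smul_left (μ := μ)]
    ring
  rw [hexp]
  -- `c = m/√Z = a√Z`, `|a|·Z = |c|√Z`, etc.
  have hc : |m| / Real.sqrt Z = |a| * Real.sqrt Z := by
    rw [ha, abs_div, abs_of_pos hZ]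
    field_simp
    rw [Real.sq_sqrt hZ.le]
  have hc' : |m'| / Real.sqrt Z = |a'| * Real.sqrt Z := by
    rw [ha', abs_div, abs_of_pos hZ]
    field_simp
    rw [Real.sq_sqrt hZ.le]
  rw [hc, hc']
  have hZs : Real.sqrt Z * Real.sqrt Z = Z := Real.mul_self_sqrt hZ.le
  have t1 : a * a' * (∫ x, ∫ y, Θ x * M x y * Θ y ∂μ ∂μ) ≤ (1 + η) * Λ * (|a| * Real.sqrt Z * (|a'| * Real.sqrt Z)) := by
    have hB0Θ : 0 ≤ ∫ x, ∫ y, Θ x * M x y * Θ y ∂μ ∂μ := hpsd Θ hΘ ⟨_, hΘb⟩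
    calc a * a' * (∫ x, ∫ y, Θ x * M x y * Θ y ∂μ ∂μ) ≤ |a * a'| * (∫ x, ∫ y, Θ x * M x y * Θ y ∂μ ∂μ) :=
          mul_le_mul_of_nonneg_right (le_abs_self _) hB0Θ
      _ ≤ |a * a'| * ((1 + η) * Λ * Z) := mul_le_mul_of_nonneg_left hB11 (abs_nonneg _)
      _ = (1 + η) * Λ * (|a| * Real.sqrt Z * (|a'| * Real.sqrt Z)) := by
          rw [abs_mul]; linear_combination (-(1 + η) * Λ * |a| * |a'|) * hZs
  have t2 : a * (∫ x, ∫ y, Θ x * M x y * h' y ∂μ ∂μ) ≤ η₂ * Λ * (|a| * Real.sqrt Z) * Real.sqrt N' := by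
    calc a * (∫ x, ∫ y, Θ x * M x y * h' y ∂μ ∂μ) ≤ |a| * |∫ x, ∫ y, Θ x * M x y * h' y ∂μ ∂μ| := by
          rw [← abs_mul]; exact le_abs_self _
      _ ≤ |a| * (η₂ * Λ * Real.sqrt Z * Real.sqrt N') := mul_le_mul_of_nonneg_left (hX1.trans (mul_le_mul_of_nonneg_left hnh'_le (by positivity))) (abs_nonneg _)
      _ = η₂ * Λ * (|a| * Real.sqrt Z) * Real.sqrt N' := by ring
  have t3 : a' * (∫ x, ∫ y, h x * M x y * Θ y ∂μ ∂μ) ≤ η₂ * Λ * (|a'| * Real.sqrt Z) * Real.sqrt N := by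
    calc a' * (∫ x, ∫ y, h x * M x y * Θ y ∂μ ∂μ) ≤ |a'| * |∫ x, ∫ y, h x * M x y * Θ y ∂μ ∂μ| := by
          rw [← abs_mul]; exact le_abs_self _
      _ ≤ |a'| * (η₂ * Λ * Real.sqrt Z * Real.sqrt N) := mul_le_mul_of_nonneg_left (hX2.trans (mul_le_mul_of_nonneg_left hnh_le (by positivity))) (abs_nonneg _)
      _ = η₂ * Λ * (|a'| * Real.sqrt Z) * Real.sqrt N := by ring
  have t4 : ∫ x, ∫ y, h x * M x y * h' y ∂μ ∂μ ≤ Λ * (1 - θ₁) * (Real.sqrt N * Real.sqrt N') :=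
    hX3.trans (mul_le_mul_of_nonneg_left (mul_le_mul hnh_le hnh'_le (Real.sqrt_nonneg _) (Real.sqrt_nonneg _)) (by positivity))
  nlinarith [t1, t2, t3, t4]

end Bilinear

end Summit.QuantumFields.YangMills.Theorems.FemtoTransferGap.StiffDoor

end
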